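import Summits.ResolutionOfSingularities.ResolutionOfSingularities.Theorems.FrobeniusLadderFRationalResolutionFixedStratumResidue
import Summits.ResolutionOfSingularities.ResolutionOfSingularities.Theorems.FrobeniusLadderFRationalResolutionFixedStratumChains
import Summits.ResolutionOfSingularities.ResolutionOfSingularities.Theorems.FrobeniusLadderFRationalResolutionChartAlgebraFixedPointDim
import Literature.AlgebraicGeometry.Resolution.RegularLocalRingsProofs
import HarnessLib

/-!
# Crux `FrobeniusLadder.FRationalResolution` (stmt-ResolutionOfSingularities-15317), line `redirect`,
# stub `stub_diagonalizableQuotientResolution` — **Kato's condition (2.1)(i) at a torus-fixed STRATUM point: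
# `C_𝔓 ⧸ I(𝔓, χ)C_𝔓 ≅ A_𝔭 ⧸ I(𝔭, φ)A_𝔭`** (brick of design C3 = the rank-2 stratum layer of the non-isolated case,
# memo MEMO-15317-leafhand2-g10 §2 (L2); assembles `…FixedStratumResidue` (surjectivity) and `…FixedStratumChains`
# (the fixed prime over the generic point of the stratum) — no zero-dimensional-stratum hypothesis)

Setting as in `…ChartAlgebraFixedPoint`: a chart `φ : P → A` (`P` finitely generated, saturated; `A` Noetherian), a
prime `𝔭` with unit face `F_𝔭`, `L = ℤF_𝔭`, a chart algebra `C = A[χ(Q)]` with (D), (K), (S), (H), and a prime `𝔓` of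
`C` over `𝔭` containing `χ(Q ∖ L)` (a point of the torus-fixed stratum). Assume `φ` is log regular at `𝔭` AND at every
prime `𝔮 ⊆ 𝔭` containing Kato's ideal `I(𝔭, φ)` (log regularity along the stratum closure near `𝔭` — automatic when
`φ` is log regular on an open set containing `𝔭`).
* `algebraMap_mem_map_ideal_of_mul_mem` — if `s·a ∈ I(𝔓, χ)` with `s ∉ 𝔓`, `a ∈ A`, then `a ∈ I(𝔭, φ)A_𝔭`: the fixed
  prime `𝔓_η ⊆ 𝔓` over the generic point `η` of the stratum (`A_𝔭/I(𝔭)A_𝔭` is a regular local ring, hence a domain,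
  so `η := I(𝔭)A_𝔭 ∩ A` is prime; `…FixedStratumChains.exists_fixedPrime_le_of_stratum`) contains `I(𝔓, χ)` and not
  `s`, so `a ∈ 𝔓_η ∩ A = η`;
* **`ker_quotientMk_comp_localRingHom_eq`** — the kernel of `A_𝔭 → C_𝔓 ⧸ I(𝔓, χ)C_𝔓` is exactly `I(𝔭, φ)A_𝔭`;
* **`nonempty_ringEquiv_quotient_fixedPrime`** — with `…FixedStratumResidue` (surjectivity):
  `A_𝔭 ⧸ I(𝔭, φ)A_𝔭 ≃+* C_𝔓 ⧸ I(𝔓, χ)C_𝔓`;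
* **`isRegularLocalRing_quotient_fixedPrime_of_stratum`** — hence Kato's condition (2.1)(i) at `𝔓`: `C_𝔓 ⧸ I(𝔓, χ)C_𝔓`
  is a regular local ring, of the same dimension as `A_𝔭 ⧸ I(𝔭, φ)A_𝔭` (the dimension `d` of the stratum). Over a
  point of zero-dimensional stratum this is `…ChartAlgebraFixedPointDim.isRegularLocalRing_quotient_of_fixedPrime`;
  here the stratum may have any dimension. What remains for full log regularity of `χ` at `𝔓` (Kato (2.1)(ii)) is
  the lower bound `dim C_𝔓 ≥ (n − rk F_𝔓(χ)) + d`.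

Honest label: generic local algebra toward ONE leaf stub (no stub, crux or summit closed). No definitions, no named
facts, no sorry. [cite: Kato1994, Def. (2.1), (7.3), (10.1)] [cite: Niziol2006, §4]
-/

noncomputable section

-- single-problem summit: the doubled namespace component is forced
set_option linter.dupNamespace false

open IsLocalRing Literature.AlgebraicGeometry.Resolution Literature.AlgebraicGeometry.Resolution.LogChart
open Summit.ResolutionOfSingularities.ResolutionOfSingularities.Theorems.FRationalResolution.ChartAlgebraNormalForm
open Summit.ResolutionOfSingularities.ResolutionOfSingularities.Theorems.FRationalResolution.ChartAlgebraFixedPoint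
open Summit.ResolutionOfSingularities.ResolutionOfSingularities.Theorems.FRationalResolution.ChartAlgebraFixedPointDim
open Summit.ResolutionOfSingularities.ResolutionOfSingularities.Theorems.FRationalResolution.FixedStratumResidue
open Summit.ResolutionOfSingularities.ResolutionOfSingularities.Theorems.FRationalResolution.FixedStratumChains

namespace Summit.ResolutionOfSingularities.ResolutionOfSingularities.Theorems.FRationalResolution.FixedStratumQuotientIso

universe u

variable {A : Type u} [CommRing A] {n : ℕ} {P : AddSubmonoid (Fin n → ℤ)} {φ : Multiplicative P →* A}
  {𝔭 : Ideal A} [𝔭.IsPrime] {C : Type u} [CommRing C] [Algebra A C] {Q : AddSubmonoid (Fin n → ℤ)}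
  {χ : Multiplicative Q →* C} {𝔓 : Ideal C} [𝔓.IsPrime]

/-- **`s·a ∈ I(𝔓, χ)` with `s ∉ 𝔓` forces `a ∈ I(𝔭, φ)A_𝔭`.** See the module docstring (the fixed prime over the generic
point of the stratum). [cite: Kato1994, Def. (2.1), (7.3), (10.1)] -/
theorem algebraMap_mem_map_ideal_of_mul_mem [IsNoetherianRing A] (hP : P.FG)
    (hsat : ∀ (v : Fin n → ℤ) (k : ℕ), 0 < k → k • v ∈ P → v ∈ P) (hreg : IsLogRegularAt P φ 𝔭)
    (hreg' : ∀ (𝔮 : Ideal A) [𝔮.IsPrime], 𝔮 ≤ 𝔭 → ideal P φ 𝔭 ≤ 𝔮 → IsLogRegularAt P φ 𝔮)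
    (hPQ : P ≤ Q)
    (hχ : ∀ p : P, χ (Multiplicative.ofAdd ⟨(p : Fin n → ℤ), hPQ p.2⟩) =
      algebraMap A C (φ (Multiplicative.ofAdd p)))
    (hgen : Algebra.adjoin A (Set.range χ) = ⊤)
    (hD : ∀ q ∈ Q, ∃ p ∈ P, q + p ∈ P)
    (hK : ∀ a : A, algebraMap A C a = 0 → ∃ p : P, φ (Multiplicative.ofAdd p) * a = 0)
    (hS : ∀ q₁ ∈ Q, ∀ q₂ ∈ Q, q₁ + q₂ ∈ Submodule.span ℤ (faceMonoid P φ 𝔭 : Set (Fin n → ℤ)) →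
      q₁ ∈ Submodule.span ℤ (faceMonoid P φ 𝔭 : Set (Fin n → ℤ)))
    (hH : ∀ q ∈ Q, ∀ p ∈ P, q + p ∈ Submodule.span ℤ (faceMonoid P φ 𝔭 : Set (Fin n → ℤ)) →
      q ∈ Submodule.span ℤ (faceMonoid P φ 𝔭 : Set (Fin n → ℤ)))
    (h𝔓 : 𝔓.comap (algebraMap A C) = 𝔭)
    (hq : ∀ q : Q, (q : Fin n → ℤ) ∉ Submodule.span ℤ (faceMonoid P φ 𝔭 : Set (Fin n → ℤ)) →
      χ (Multiplicative.ofAdd q) ∈ 𝔓)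
    {a : A} {s : C} (hs : s ∉ 𝔓) (h : s * algebraMap A C a ∈ ideal Q χ 𝔓) :
    algebraMap A (Localization.AtPrime 𝔭) a ∈
      (ideal P φ 𝔭).map (algebraMap A (Localization.AtPrime 𝔭)) := by
  set I' := (ideal P φ 𝔭).map (algebraMap A (Localization.AtPrime 𝔭)) with hI'
  haveI hR : IsRegularLocalRing (Localization.AtPrime 𝔭 ⧸ I') := hreg.1
  haveI : IsDomain (Localization.AtPrime 𝔭 ⧸ I') := isDomain_of_isRegularLocalRing _
  haveI hI'p : I'.IsPrime := (Ideal.Quotient.isDomain_iff_prime I').mp inferInstance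
  -- the generic point of the stratum
  set η : Ideal A := I'.comap (algebraMap A (Localization.AtPrime 𝔭)) with hη
  haveI : η.IsPrime := Ideal.IsPrime.comap _
  have hle : η ≤ 𝔭 := by
    intro x hx
    have hx' : algebraMap A (Localization.AtPrime 𝔭) x ∈ maximalIdeal (Localization.AtPrime 𝔭) :=
      le_maximalIdeal hI'p.ne_top hx
    exact (IsLocalization.AtPrime.to_map_mem_maximal_iff (Localization.AtPrime 𝔭) 𝔭 x).mp hx'
  have hIη : ideal P φ 𝔭 ≤ η := Ideal.le_comap_map
  obtain ⟨𝔓₁, h𝔓₁, h𝔓₁A, h𝔓₁q, h𝔓₁le, -⟩ :=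
    exists_fixedPrime_le_of_stratum hP hsat hle hIη (hreg' η hle hIη) hPQ hχ hgen hD hK hS hH h𝔓 hq
  haveI := h𝔓₁
  -- `I(𝔓, χ) ≤ 𝔓₁`
  have hI𝔓 : ideal Q χ 𝔓 ≤ 𝔓₁ := by
    refine Ideal.span_le.2 ?_
    rintro _ ⟨q, hq𝔓, rfl⟩
    refine (h𝔓₁q q).2 fun hqL => ?_
    exact ((not_mem_iff_mem_span_of_comap_eq hPQ hχ h𝔓 hq q).2 hqL) hq𝔓
  have h1 : s * algebraMap A C a ∈ 𝔓₁ := hI𝔓 h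
  have h2 : algebraMap A C a ∈ 𝔓₁ :=
    (Ideal.IsPrime.mem_or_mem inferInstance h1).resolve_left fun hs₁ => hs (h𝔓₁le hs₁)
  have h3 : a ∈ η := by
    have : a ∈ 𝔓₁.comap (algebraMap A C) := h2
    rwa [h𝔓₁A] at this
  exact h3

/-- **The kernel of `A_𝔭 → C_𝔓 ⧸ I(𝔓, χ)C_𝔓` is `I(𝔭, φ)A_𝔭`.** [cite: Kato1994, Def. (2.1), (10.1)] -/
theorem ker_quotientMk_comp_localRingHom_eq [IsNoetherianRing A] (hP : P.FG)
    (hsat : ∀ (v : Fin n → ℤ) (k : ℕ), 0 < k → k • v ∈ P → v ∈ P) (hreg : IsLogRegularAt P φ 𝔭)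
    (hreg' : ∀ (𝔮 : Ideal A) [𝔮.IsPrime], 𝔮 ≤ 𝔭 → ideal P φ 𝔭 ≤ 𝔮 → IsLogRegularAt P φ 𝔮)
    (hPQ : P ≤ Q)
    (hχ : ∀ p : P, χ (Multiplicative.ofAdd ⟨(p : Fin n → ℤ), hPQ p.2⟩) =
      algebraMap A C (φ (Multiplicative.ofAdd p)))
    (hgen : Algebra.adjoin A (Set.range χ) = ⊤)
    (hD : ∀ q ∈ Q, ∃ p ∈ P, q + p ∈ P)
    (hK : ∀ a : A, algebraMap A C a = 0 → ∃ p : P, φ (Multiplicative.ofAdd p) * a = 0)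
    (hS : ∀ q₁ ∈ Q, ∀ q₂ ∈ Q, q₁ + q₂ ∈ Submodule.span ℤ (faceMonoid P φ 𝔭 : Set (Fin n → ℤ)) →
      q₁ ∈ Submodule.span ℤ (faceMonoid P φ 𝔭 : Set (Fin n → ℤ)))
    (hH : ∀ q ∈ Q, ∀ p ∈ P, q + p ∈ Submodule.span ℤ (faceMonoid P φ 𝔭 : Set (Fin n → ℤ)) →
      q ∈ Submodule.span ℤ (faceMonoid P φ 𝔭 : Set (Fin n → ℤ)))
    (h𝔓 : 𝔓.comap (algebraMap A C) = 𝔭)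
    (hq : ∀ q : Q, (q : Fin n → ℤ) ∉ Submodule.span ℤ (faceMonoid P φ 𝔭 : Set (Fin n → ℤ)) →
      χ (Multiplicative.ofAdd q) ∈ 𝔓) :
    RingHom.ker ((Ideal.Quotient.mk ((ideal Q χ 𝔓).map (algebraMap C (Localization.AtPrime 𝔓)))).comp
      (Localization.localRingHom 𝔭 𝔓 (algebraMap A C) h𝔓.symm)) =
      (ideal P φ 𝔭).map (algebraMap A (Localization.AtPrime 𝔭)) := by
  refine le_antisymm ?_ ?_
  · intro α hα
    rw [RingHom.mem_ker, RingHom.comp_apply, Ideal.Quotient.eq_zero_iff_mem] at hα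
    obtain ⟨⟨a, u⟩, rfl⟩ := IsLocalization.mk'_surjective 𝔭.primeCompl α
    rw [Localization.localRingHom_mk', IsLocalization.mk'_mem_iff] at hα
    rw [IsLocalization.mk'_mem_iff]
    -- `algebraMap A C a ∈ I(𝔓)C_𝔓 ∩ C`: clear the denominator
    obtain ⟨⟨i, t⟩, hit⟩ := (IsLocalization.mem_map_algebraMap_iff 𝔓.primeCompl (Localization.AtPrime 𝔓)).1 hα
    obtain ⟨c, hc⟩ := (IsLocalization.eq_iff_exists 𝔓.primeCompl (Localization.AtPrime 𝔓)).1
      (show algebraMap C (Localization.AtPrime 𝔓) (algebraMap A C a * (t : C)) =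
          algebraMap C (Localization.AtPrime 𝔓) (i : C) by rw [map_mul]; exact hit)
    have hmem : ((c : C) * (t : C)) * algebraMap A C a ∈ ideal Q χ 𝔓 := by
      have e : ((c : C) * (t : C)) * algebraMap A C a = (c : C) * (i : C) := by
        rw [← hc]; ring
      rw [e]
      exact Ideal.mul_mem_left _ _ i.2
    have hct : (c : C) * (t : C) ∉ 𝔓 := fun hmem' =>
      (Ideal.IsPrime.mem_or_mem inferInstance hmem').elim c.2 t.2
    exact algebraMap_mem_map_ideal_of_mul_mem hP hsat hreg hreg' hPQ hχ hgen hD hK hS hH h𝔓 hq hct hmem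
  · rw [Ideal.map_le_iff_le_comap]
    intro i hi
    rw [Ideal.mem_comap, RingHom.mem_ker, RingHom.comp_apply, Localization.localRingHom_to_map,
      Ideal.Quotient.eq_zero_iff_mem]
    exact Ideal.mem_map_of_mem _ (map_ideal_le_ideal hPQ hχ h𝔓 (Ideal.mem_map_of_mem _ hi))

/-- **`A_𝔭 ⧸ I(𝔭, φ)A_𝔭 ≃+* C_𝔓 ⧸ I(𝔓, χ)C_𝔓`** at a torus-fixed stratum point. [cite: Kato1994, Def. (2.1), (10.1)] -/
theorem nonempty_ringEquiv_quotient_fixedPrime [IsNoetherianRing A] (hP : P.FG)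
    (hsat : ∀ (v : Fin n → ℤ) (k : ℕ), 0 < k → k • v ∈ P → v ∈ P) (hreg : IsLogRegularAt P φ 𝔭)
    (hreg' : ∀ (𝔮 : Ideal A) [𝔮.IsPrime], 𝔮 ≤ 𝔭 → ideal P φ 𝔭 ≤ 𝔮 → IsLogRegularAt P φ 𝔮)
    (hPQ : P ≤ Q)
    (hχ : ∀ p : P, χ (Multiplicative.ofAdd ⟨(p : Fin n → ℤ), hPQ p.2⟩) =
      algebraMap A C (φ (Multiplicative.ofAdd p)))
    (hgen : Algebra.adjoin A (Set.range χ) = ⊤)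
    (hD : ∀ q ∈ Q, ∃ p ∈ P, q + p ∈ P)
    (hK : ∀ a : A, algebraMap A C a = 0 → ∃ p : P, φ (Multiplicative.ofAdd p) * a = 0)
    (hS : ∀ q₁ ∈ Q, ∀ q₂ ∈ Q, q₁ + q₂ ∈ Submodule.span ℤ (faceMonoid P φ 𝔭 : Set (Fin n → ℤ)) →
      q₁ ∈ Submodule.span ℤ (faceMonoid P φ 𝔭 : Set (Fin n → ℤ)))
    (hH : ∀ q ∈ Q, ∀ p ∈ P, q + p ∈ Submodule.span ℤ (faceMonoid P φ 𝔭 : Set (Fin n → ℤ)) →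
      q ∈ Submodule.span ℤ (faceMonoid P φ 𝔭 : Set (Fin n → ℤ)))
    (h𝔓 : 𝔓.comap (algebraMap A C) = 𝔭)
    (hq : ∀ q : Q, (q : Fin n → ℤ) ∉ Submodule.span ℤ (faceMonoid P φ 𝔭 : Set (Fin n → ℤ)) →
      χ (Multiplicative.ofAdd q) ∈ 𝔓) :
    Nonempty ((Localization.AtPrime 𝔭 ⧸ (ideal P φ 𝔭).map (algebraMap A (Localization.AtPrime 𝔭))) ≃+*
      (Localization.AtPrime 𝔓 ⧸ (ideal Q χ 𝔓).map (algebraMap C (Localization.AtPrime 𝔓)))) := by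
  set F := (Ideal.Quotient.mk ((ideal Q χ 𝔓).map (algebraMap C (Localization.AtPrime 𝔓)))).comp
    (Localization.localRingHom 𝔭 𝔓 (algebraMap A C) h𝔓.symm) with hF
  have hsurj : Function.Surjective F :=
    surjective_quotientMk_comp_localRingHom_of_fixedPrime hPQ hχ hgen h𝔓 hq
  have hker : RingHom.ker F = (ideal P φ 𝔭).map (algebraMap A (Localization.AtPrime 𝔭)) :=
    ker_quotientMk_comp_localRingHom_eq hP hsat hreg hreg' hPQ hχ hgen hD hK hS hH h𝔓 hq
  exact ⟨(Ideal.quotEquivOfEq hker.symm).trans (RingHom.quotientKerEquivOfSurjective hsurj)⟩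

/-- **Kato's condition (2.1)(i) at a torus-fixed STRATUM point.** Under the hypotheses of
`nonempty_ringEquiv_quotient_fixedPrime`, `C_𝔓 ⧸ I(𝔓, χ)C_𝔓` is a regular local ring and
`dim (C_𝔓 ⧸ I(𝔓, χ)C_𝔓) = dim (A_𝔭 ⧸ I(𝔭, φ)A_𝔭)`. [cite: Kato1994, Def. (2.1), (10.1)] -/
theorem isRegularLocalRing_quotient_fixedPrime_of_stratum [IsNoetherianRing A] (hP : P.FG)
    (hsat : ∀ (v : Fin n → ℤ) (k : ℕ), 0 < k → k • v ∈ P → v ∈ P) (hreg : IsLogRegularAt P φ 𝔭)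
    (hreg' : ∀ (𝔮 : Ideal A) [𝔮.IsPrime], 𝔮 ≤ 𝔭 → ideal P φ 𝔭 ≤ 𝔮 → IsLogRegularAt P φ 𝔮)
    (hPQ : P ≤ Q)
    (hχ : ∀ p : P, χ (Multiplicative.ofAdd ⟨(p : Fin n → ℤ), hPQ p.2⟩) =
      algebraMap A C (φ (Multiplicative.ofAdd p)))
    (hgen : Algebra.adjoin A (Set.range χ) = ⊤)
    (hD : ∀ q ∈ Q, ∃ p ∈ P, q + p ∈ P)
    (hK : ∀ a : A, algebraMap A C a = 0 → ∃ p : P, φ (Multiplicative.ofAdd p) * a = 0)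
    (hS : ∀ q₁ ∈ Q, ∀ q₂ ∈ Q, q₁ + q₂ ∈ Submodule.span ℤ (faceMonoid P φ 𝔭 : Set (Fin n → ℤ)) →
      q₁ ∈ Submodule.span ℤ (faceMonoid P φ 𝔭 : Set (Fin n → ℤ)))
    (hH : ∀ q ∈ Q, ∀ p ∈ P, q + p ∈ Submodule.span ℤ (faceMonoid P φ 𝔭 : Set (Fin n → ℤ)) →
      q ∈ Submodule.span ℤ (faceMonoid P φ 𝔭 : Set (Fin n → ℤ)))
    (h𝔓 : 𝔓.comap (algebraMap A C) = 𝔭)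
    (hq : ∀ q : Q, (q : Fin n → ℤ) ∉ Submodule.span ℤ (faceMonoid P φ 𝔭 : Set (Fin n → ℤ)) →
      χ (Multiplicative.ofAdd q) ∈ 𝔓) :
    IsRegularLocalRing (Localization.AtPrime 𝔓 ⧸ (ideal Q χ 𝔓).map (algebraMap C (Localization.AtPrime 𝔓))) ∧
      ringKrullDim (Localization.AtPrime 𝔓 ⧸ (ideal Q χ 𝔓).map (algebraMap C (Localization.AtPrime 𝔓))) =
        ringKrullDim (Localization.AtPrime 𝔭 ⧸ (ideal P φ 𝔭).map (algebraMap A (Localization.AtPrime 𝔭))) := by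
  obtain ⟨e⟩ := nonempty_ringEquiv_quotient_fixedPrime hP hsat hreg hreg' hPQ hχ hgen hD hK hS hH h𝔓 hq
  haveI : IsRegularLocalRing (Localization.AtPrime 𝔭 ⧸
      (ideal P φ 𝔭).map (algebraMap A (Localization.AtPrime 𝔭))) := hreg.1
  exact ⟨IsRegularLocalRing.of_ringEquiv e, (ringKrullDim_eq_of_ringEquiv e).symm⟩

end Summit.ResolutionOfSingularities.ResolutionOfSingularities.Theorems.FRationalResolution.FixedStratumQuotientIso

end
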